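import Literature.Claims.NS.Wu2026
import Mathlib.Analysis.SpecialFunctions.SmoothTransition
import Mathlib.Analysis.Calculus.ContDiff.Deriv
import Mathlib.MeasureTheory.Integral.IntervalIntegral.FundThmCalculus
import HarnessLib

/-!
# C177 `Wu2026` — TRUE column, Prop 3.4 (part 1/4): radial test functions and the decomposition
# of radial profiles

D-0090 NS-CLAIMS sweep, claim C177 (W. Wu, arXiv:2608.22471v1), skeleton
`Literature/Claims/NS/Wu2026.lean` (typist-10 g6; rev 2 p560520); TRUE-column kernel objects for the
consumed binder `hP34` of `claim_of_steps''` — Proposition 3.4 p.22 l.3–8 (proof p.22 l.9 – p.23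
l.46) «For every τ > 0, F_τ = 0. (3.66) Moreover, ∫_{S_r} QV·n dS = 0 for almost every r > 0.
(3.67)», typed as `Step_P34` (companion laws `div(β(Q)V) = 0` in `D'({|y| > 1})` for all
`β ∈ C¹` with `β'` bounded ⟹ `ZeroRadialFlux (Ioi 1) T.V T.Q`). Records, not a verdict (row #164
lettered «discharges», RULINGS v1.51/v1.54); salvage-p1 g5 (DECONFLICT 20:19Z).

This file: for `h ∈ C_c^∞((1,∞))`, `φ = h ∘ |·|` is a test function on `{|y| > 1}` with
`⟪W, ∇φ⟫ = h'(|y|) W·y/|y|` (`isTest_radial`), so a companion law `div(β(Q)V) = 0` kills the radial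
derivative of the flux functional, `∫ h'(|y|) β(Q)V·y/|y| = 0` (`flux_deriv_eq_zero`; p.21 l.81–89);
and every `η ∈ C_c^∞((1,∞))` decomposes as `η = h_R' + (∫η) g_R` with `h_R ∈ C_c^∞((1,∞))`,
`g_R = O(1/R)` supported in `(R, 2R)` (`exists_radial_decomposition`).

WHAT THIS IS NOT: not a claim about NS regularity or blow-up; not a claim about any author beyond
the typed locator.
-/

noncomputable section

set_option linter.dupNamespace false

open MeasureTheory Set Function Filter Topology Metric
open scoped ENNReal NNReal RealInnerProductSpace Topology

namespace Summit.NavierStokesRegularity.NavierStokesRegularity.Theorems.Wu2026Salvage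

open Literature.Analysis.FluidPDE Literature.Analysis.FunctionSpaces Literature.Claims.NS.Wu2026

/-! ### Radial test functions `φ = h ∘ |·|`, `h ∈ C_c^∞((1,∞))` -/

/-- A profile `h ∈ C_c^∞((1,∞))` vanishes below some `a > 1` and above some `b`. [folklore] -/
theorem exists_bounds_of_isTestRad {h : ℝ → ℝ} (hh : IsTestRad (Ioi 1) h) :
    ∃ a b : ℝ, 1 < a ∧ (∀ r, r < a → h r = 0) ∧ (∀ r, b < r → h r = 0) := by
  obtain ⟨hC, hc, hsupp⟩ := hh
  have hK : IsCompact (tsupport h) := hc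
  obtain ⟨M, hM⟩ := hK.isBounded.subset_closedBall 0
  by_cases hne : (tsupport h).Nonempty
  · have ha : sInf (tsupport h) ∈ tsupport h := hK.sInf_mem hne
    refine ⟨sInf (tsupport h), M, hsupp ha, fun r hr => ?_, fun r hr => ?_⟩
    · refine image_eq_zero_of_notMem_tsupport fun hr' => ?_
      exact absurd (csInf_le hK.bddBelow hr') (not_le.2 hr)
    · refine image_eq_zero_of_notMem_tsupport fun hr' => ?_
      have := hM hr'
      rw [mem_closedBall, dist_zero_right, Real.norm_eq_abs] at this
      exact absurd (le_abs_self r) (not_le.2 (lt_of_le_of_lt this hr))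
  · rw [not_nonempty_iff_eq_empty] at hne
    refine ⟨2, 0, one_lt_two, fun r _ => ?_, fun r _ => ?_⟩ <;>
      exact image_eq_zero_of_notMem_tsupport (by simp [hne])

/-- The derivative of the norm away from the origin (local copy of a standard fact):
`D|·|(y) = ⟨y, ·⟩/|y|`. [folklore] -/
private theorem hasFDerivAt_norm_of_ne_zero_rad {y : E3} (hy : y ≠ 0) :
    HasFDerivAt (fun z : E3 => ‖z‖) (‖y‖⁻¹ • innerSL ℝ y) y := by
  have hpos : 0 < ‖y‖ := norm_pos_iff.2 hy
  have h1 : HasFDerivAt (fun z : E3 => ‖z‖ ^ 2) (2 • innerSL ℝ y) y :=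
    (hasStrictFDerivAt_norm_sq y).hasFDerivAt
  have h2 := h1.sqrt (pow_ne_zero 2 hpos.ne')
  have heq : (fun z : E3 => Real.sqrt (‖z‖ ^ 2)) = fun z => ‖z‖ :=
    funext fun z => Real.sqrt_sq (norm_nonneg z)
  rw [heq] at h2
  refine h2.congr_fderiv ?_
  ext u
  simp only [FunLike.coe_smul, Pi.smul_apply, innerSL_apply_apply, smul_eq_mul,
    nsmul_eq_mul, Nat.cast_ofNat, Pi.mul_apply, Pi.ofNat_apply, Real.sqrt_sq hpos.le]
  field_simp

/-- **Radial test functions.** For `h ∈ C_c^∞((1,∞))`, `φ(y) = h(|y|)` is a test function on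
`{|y| > 1}` and `⟪W, ∇φ(y)⟫ = h'(|y|) ⟪W, y⟫/|y|` for every `W` and every `y`
(p.19 l.95–104, p.21 l.81–89: «testing against radial functions»). [cite: Wu2026, p.19 l.95–104 and p.21 l.81–89] -/
theorem isTest_radial {h : ℝ → ℝ} (hh : IsTestRad (Ioi 1) h) :
    IsTest exterior (fun y : E3 => h ‖y‖) ∧
      ∀ (W y : E3), ⟪W, gradient (fun y : E3 => h ‖y‖) y⟫ = deriv h ‖y‖ * (⟪W, y⟫ / ‖y‖) := by
  obtain ⟨a, b, ha1, ha, hb⟩ := exists_bounds_of_isTestRad hh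
  obtain ⟨hC, hc, hsupp⟩ := hh
  set φ : E3 → ℝ := fun y => h ‖y‖ with hφ
  -- `φ` vanishes on the open set `{‖y‖ < a}` and `h` on the open set `(-∞, a)`
  have hzero : ∀ y : E3, ‖y‖ < a → φ =ᶠ[𝓝 y] fun _ => 0 := by
    intro y hy
    filter_upwards [(isOpen_lt continuous_norm continuous_const).mem_nhds hy] with z hz
    exact ha _ hz
  have hzero' : ∀ r : ℝ, r < a → h =ᶠ[𝓝 r] fun _ => 0 := by
    intro r hr
    filter_upwards [(isOpen_gt' a).mem_nhds hr] with s hs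
    exact ha _ hs
  have hderiv0 : ∀ r : ℝ, r < a → deriv h r = 0 := fun r hr => by
    rw [(hzero' r hr).deriv_eq]; exact deriv_const r 0
  -- the derivative of `φ` at points with `‖y‖ ≥ a`
  have hD : ∀ y : E3, a ≤ ‖y‖ →
      HasFDerivAt φ (deriv h ‖y‖ • (‖y‖⁻¹ • innerSL ℝ y)) y := by
    intro y hy
    have hy0 : y ≠ 0 := by
      intro h0; rw [h0, norm_zero] at hy; linarith
    have h1 : HasDerivAt h (deriv h ‖y‖) ‖y‖ :=
      ((hC.differentiable (by simp)) ‖y‖).hasDerivAt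
    exact h1.comp_hasFDerivAt y (hasFDerivAt_norm_of_ne_zero_rad hy0)
  refine ⟨⟨?_, ?_, ?_⟩, fun W y => ?_⟩
  · -- smoothness
    refine contDiff_iff_contDiffAt.2 fun y => ?_
    by_cases hy : ‖y‖ < a
    · exact (contDiffAt_const (c := (0 : ℝ))).congr_of_eventuallyEq (hzero y hy)
    · have hy0 : y ≠ 0 := by
        intro h0; rw [h0, norm_zero] at hy; linarith
      exact hC.contDiffAt.comp y (contDiffAt_norm ℝ hy0)
  · -- compact support: `φ = 0` off the closed ball of radius `b`
    refine HasCompactSupport.intro (isCompact_closedBall (0 : E3) b) fun y hy => ?_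
    rw [mem_closedBall_zero_iff, not_le] at hy
    exact hb _ hy
  · -- support inside `{|y| > 1}`
    have hcl : IsClosed {y : E3 | a ≤ ‖y‖} := isClosed_le continuous_const continuous_norm
    refine (closure_minimal (fun y hy => ?_) hcl).trans fun y hy => ?_
    · by_contra hya
      simp only [mem_setOf_eq, not_le] at hya
      exact hy (ha _ hya)
    · exact lt_of_lt_of_le ha1 hy
  · -- the gradient formula
    rw [real_inner_comm, gradient, InnerProductSpace.toDual_symm_apply]
    by_cases hy : ‖y‖ < a
    · have h0 : fderiv ℝ φ y = 0 := by
        rw [(hzero y hy).fderiv_eq]; exact fderiv_const_apply 0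
      rw [h0, hderiv0 _ hy]
      simp
    · push Not at hy
      rw [(hD y hy).fderiv]
      simp only [FunLike.coe_smul, Pi.smul_apply, innerSL_apply_apply, smul_eq_mul,
        real_inner_comm y W]
      rw [div_eq_mul_inv]
      ring

/-- **The companion law kills radial derivatives of the flux**: if `div(β(Q)V) = 0` in
`D'({|y| > 1})`, then `∫ h'(|y|) β(Q)V·y/|y| dy = 0` for every `h ∈ C_c^∞((1,∞))` (p.21 l.81–89,
the radial testing behind (3.64)–(3.65)). [cite: Wu2026, (3.64)–(3.65) p.21 l.81–89] -/
theorem flux_deriv_eq_zero {V : E3 → E3} {Q : E3 → ℝ} {β : ℝ → ℝ}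
    (hlaw : WeakDivFreeOn exterior (fun y => β (Q y) • V y)) {h : ℝ → ℝ} (hh : IsTestRad (Ioi 1) h) :
    ∫ y : E3, deriv h ‖y‖ * (β (Q y) * ⟪V y, y⟫ / ‖y‖) = 0 := by
  obtain ⟨htest, hgrad⟩ := isTest_radial hh
  have h0 := hlaw _ htest
  rw [← h0]
  refine integral_congr_ae (Eventually.of_forall fun y => ?_)
  show deriv h ‖y‖ * (β (Q y) * ⟪V y, y⟫ / ‖y‖) = ⟪β (Q y) • V y, gradient (fun y => h ‖y‖) y⟫
  rw [hgrad (β (Q y) • V y) y, real_inner_smul_left, mul_div_assoc]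


/-! ### Smooth steps and the decomposition `η = h_R' + (∫η) g_R` -/

/-- The derivative of Mathlib's `smoothTransition` is bounded and vanishes off `[0, 1]`. [folklore] -/
theorem exists_deriv_smoothTransition_bound :
    ∃ K : ℝ, 0 ≤ K ∧ (∀ x, |deriv Real.smoothTransition x| ≤ K) ∧
      (∀ x, x < 0 → deriv Real.smoothTransition x = 0) ∧
      (∀ x, 1 < x → deriv Real.smoothTransition x = 0) := by
  have hC : ContDiff ℝ 1 Real.smoothTransition := Real.smoothTransition.contDiff
  have hcont : Continuous (deriv Real.smoothTransition) := hC.continuous_deriv le_rfl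
  have hneg : ∀ x, x < 0 → deriv Real.smoothTransition x = 0 := by
    intro x hx
    have hev : Real.smoothTransition =ᶠ[𝓝 x] fun _ => (0 : ℝ) := by
      filter_upwards [Iio_mem_nhds hx] with y hy
      exact Real.smoothTransition.zero_of_nonpos (le_of_lt hy)
    rw [hev.deriv_eq]; exact deriv_const x 0
  have hpos : ∀ x, 1 < x → deriv Real.smoothTransition x = 0 := by
    intro x hx
    have hev : Real.smoothTransition =ᶠ[𝓝 x] fun _ => (1 : ℝ) := by
      filter_upwards [Ioi_mem_nhds hx] with y hy
      exact Real.smoothTransition.one_of_one_le (le_of_lt hy)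
    rw [hev.deriv_eq]; exact deriv_const x 1
  have hsupp : HasCompactSupport (deriv Real.smoothTransition) := by
    refine HasCompactSupport.intro (isCompact_Icc (a := (0 : ℝ)) (b := 1)) fun x hx => ?_
    rw [mem_Icc, not_and_or, not_le, not_le] at hx
    rcases hx with hx | hx
    · exact hneg x hx
    · exact hpos x hx
  obtain ⟨C, hCb⟩ := hcont.bounded_above_of_compact_support hsupp
  refine ⟨max C 0, le_max_right _ _, fun x => ?_, hneg, hpos⟩
  rw [← Real.norm_eq_abs]
  exact (hCb x).trans (le_max_left _ _)

/-- **Decomposition of radial profiles.** For `η ∈ C_c^∞((1,∞))` and `R > 1` there are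
`h_R ∈ C_c^∞((1,∞))` and a continuous profile `g_R` supported in the open dyadic range `(R, 2R)`
with `|g_R| ≤ 2K/R` (`K` any bound for `smoothTransition'`), such that `η = h_R' + (∫η) g_R`
(`h_R = H − (∫η) S_R`, `H` the primitive of `η`, `S_R(r) = smoothTransition(2(r − R)/R − 1/2)`). [folklore] -/
theorem exists_radial_decomposition {η : ℝ → ℝ} (hη : IsTestRad (Ioi 1) η) {K : ℝ}
    (hKb : ∀ x, |deriv Real.smoothTransition x| ≤ K)
    (hKneg : ∀ x, x < 0 → deriv Real.smoothTransition x = 0)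
    (hKpos : ∀ x, 1 < x → deriv Real.smoothTransition x = 0) {R : ℝ} (hR : 1 < R) :
    ∃ (hR' : ℝ → ℝ) (g : ℝ → ℝ), IsTestRad (Ioi 1) hR' ∧ Continuous g ∧
      (∀ r, η r = deriv hR' r + (∫ s, η s) * g r) ∧ (∀ r, |g r| ≤ 2 * K / R) ∧
      (∀ r, g r ≠ 0 → R < r ∧ r < 2 * R) := by
  obtain ⟨a, b, ha1, ha, hb⟩ := exists_bounds_of_isTestRad hη
  obtain ⟨hηC, hηc, hηsupp⟩ := hη
  have hR0 : 0 < R := lt_trans zero_lt_one hR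
  have hηcont : Continuous η := hηC.continuous
  -- the primitive `H` of `η`
  set H : ℝ → ℝ := fun r => ∫ s in (0 : ℝ)..r, η s with hH
  have hHd : ∀ r, HasDerivAt H (η r) r := fun r =>
    intervalIntegral.integral_hasDerivAt_right (hηcont.intervalIntegrable _ _)
      (hηcont.stronglyMeasurableAtFilter _ _) hηcont.continuousAt
  have hHderiv : deriv H = η := funext fun r => (hHd r).deriv
  have hHC : ContDiff ℝ (⊤ : ℕ∞) H := by
    rw [contDiff_infty_iff_deriv, hHderiv]
    exact ⟨fun r => (hHd r).differentiableAt, hηC⟩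
  -- `H = 0` below `a`, `H = m` above `b`
  set m : ℝ := ∫ s, η s with hm
  have hsuppη : support η ⊆ Icc a b := by
    intro s hs
    rw [mem_support] at hs
    constructor
    · by_contra h; exact hs (ha s (not_le.1 h))
    · by_contra h; exact hs (hb s (not_le.1 h))
  have hH0 : ∀ r, r < a → H r = 0 := by
    intro r hr
    have hzero : ∀ s ∈ uIcc (0 : ℝ) r, η s = 0 := by
      intro s hs
      refine ha s ?_
      rcases le_total 0 r with h0r | hr0
      · rw [uIcc_of_le h0r] at hs; exact lt_of_le_of_lt hs.2 hr
      · rw [uIcc_of_ge hr0] at hs; exact lt_of_le_of_lt hs.2 (lt_trans (by linarith) ha1) |>.trans_le le_rfl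
    show ∫ s in (0 : ℝ)..r, η s = 0
    rw [intervalIntegral.integral_congr (g := fun _ => (0 : ℝ)) hzero]
    simp
  have hHm : ∀ r, b < r → H r = m := by
    intro r hr
    show ∫ s in (0 : ℝ)..r, η s = ∫ s, η s
    refine intervalIntegral.integral_eq_integral_of_support_subset (hsuppη.trans fun s hs => ?_)
    exact ⟨lt_of_lt_of_le (lt_trans zero_lt_one ha1) hs.1, hs.2.trans hr.le⟩
  -- the smooth step `S_R` and its derivative `g`
  set S : ℝ → ℝ := fun r => Real.smoothTransition (2 * (r - R) / R - 1 / 2) with hS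
  set g : ℝ → ℝ := fun r => 2 / R * deriv Real.smoothTransition (2 * (r - R) / R - 1 / 2) with hg
  have hlin : ∀ r, HasDerivAt (fun r : ℝ => 2 * (r - R) / R - 1 / 2) (2 / R) r := by
    intro r
    refine ((((hasDerivAt_id' r).sub_const R).const_mul 2).div_const R |>.sub_const (1 / 2)).congr_deriv ?_
    ring
  have hSd : ∀ r, HasDerivAt S (g r) r := by
    intro r
    have h1 := (Real.smoothTransition.contDiff (n := 1)).differentiable one_ne_zero
      (2 * (r - R) / R - 1 / 2) |>.hasDerivAt
    have h2 := h1.comp r (hlin r)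
    refine h2.congr_deriv ?_
    show deriv Real.smoothTransition (2 * (r - R) / R - 1 / 2) * (2 / R) = g r
    rw [hg]; ring
  have hSC : ContDiff ℝ (⊤ : ℕ∞) S :=
    Real.smoothTransition.contDiff.comp
      (((contDiff_const.mul (contDiff_id.sub contDiff_const)).div_const R).sub contDiff_const)
  have hS0 : ∀ r, r ≤ 5 * R / 4 → S r = 0 := by
    intro r hr
    apply Real.smoothTransition.zero_of_nonpos
    rw [sub_nonpos, div_le_iff₀ hR0]
    linarith
  have hS1 : ∀ r, 7 * R / 4 ≤ r → S r = 1 := by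
    intro r hr
    apply Real.smoothTransition.one_of_one_le
    rw [le_sub_iff_add_le, le_div_iff₀ hR0]
    linarith
  have hgcont : Continuous g :=
    continuous_const.mul (((Real.smoothTransition.contDiff (n := 1)).continuous_deriv le_rfl).comp
      (((continuous_const.mul (continuous_id.sub continuous_const)).div_const R).sub continuous_const))
  have hgbound : ∀ r, |g r| ≤ 2 * K / R := by
    intro r
    rw [hg]
    show |2 / R * deriv Real.smoothTransition (2 * (r - R) / R - 1 / 2)| ≤ 2 * K / R
    rw [abs_mul, abs_of_pos (div_pos two_pos hR0)]
    calc 2 / R * |deriv Real.smoothTransition (2 * (r - R) / R - 1 / 2)| ≤ 2 / R * K := by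
          gcongr; exact hKb _
      _ = 2 * K / R := by ring
  have hgsupp : ∀ r, g r ≠ 0 → R < r ∧ r < 2 * R := by
    intro r hr
    rw [hg] at hr
    have hne : deriv Real.smoothTransition (2 * (r - R) / R - 1 / 2) ≠ 0 := by
      intro h0
      apply hr
      show 2 / R * deriv Real.smoothTransition (2 * (r - R) / R - 1 / 2) = 0
      rw [h0, mul_zero]
    have h0 : 0 ≤ 2 * (r - R) / R - 1 / 2 := by
      by_contra h; exact hne (hKneg _ (not_le.1 h))
    have h1 : 2 * (r - R) / R - 1 / 2 ≤ 1 := by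
      by_contra h; exact hne (hKpos _ (not_le.1 h))
    rw [sub_nonneg, le_div_iff₀ hR0] at h0
    rw [sub_le_iff_le_add, div_le_iff₀ hR0] at h1
    constructor <;> linarith
  -- the corrected primitive `h_R = H − m S_R`
  set h₁ : ℝ → ℝ := fun r => H r - m * S r with hh₁
  have hh₁d : ∀ r, HasDerivAt h₁ (η r - m * g r) r := fun r =>
    (hHd r).sub ((hSd r).const_mul m)
  have hh₁C : ContDiff ℝ (⊤ : ℕ∞) h₁ := hHC.sub (contDiff_const.mul hSC)
  set a₀ : ℝ := min a (5 * R / 4) with ha₀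
  set b₀ : ℝ := max b (7 * R / 4) with hb₀
  have ha₀1 : 1 < a₀ := lt_min ha1 (by linarith)
  have hzero : ∀ r, r ∉ Icc a₀ b₀ → h₁ r = 0 := by
    intro r hr
    rw [mem_Icc, not_and_or, not_le, not_le] at hr
    rcases hr with hr | hr
    · have hra : r < a := lt_of_lt_of_le hr (min_le_left _ _)
      have hrR : r ≤ 5 * R / 4 := (le_of_lt (lt_of_lt_of_le hr (min_le_right _ _)))
      show H r - m * S r = 0
      rw [hH0 r hra, hS0 r hrR]; ring
    · have hrb : b < r := lt_of_le_of_lt (le_max_left _ _) hr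
      have hrR : 7 * R / 4 ≤ r := (le_max_right _ _).trans hr.le
      show H r - m * S r = 0
      rw [hHm r hrb, hS1 r hrR]; ring
  have hh₁test : IsTestRad (Ioi 1) h₁ := by
    refine ⟨hh₁C, HasCompactSupport.intro isCompact_Icc hzero, ?_⟩
    have hsub : support h₁ ⊆ Icc a₀ b₀ := fun r hr => by
      by_contra h; exact hr (hzero r h)
    refine (closure_minimal hsub isClosed_Icc).trans fun r hr => ?_
    exact lt_of_lt_of_le ha₀1 hr.1
  refine ⟨h₁, g, hh₁test, hgcont, fun r => ?_, hgbound, hgsupp⟩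
  rw [(hh₁d r).deriv]; ring


end Summit.NavierStokesRegularity.NavierStokesRegularity.Theorems.Wu2026Salvage
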